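import Literature.Probability.RandomPlanarGeometry.PolylineVertexToCurve
import Literature.Probability.Percolation.BoxCrossingProofs
import HarnessLib

/-!
# Mesh polylines of lattice walks versus their discrete shell traversals
(crux `SAWLeftRightFKG.FKGToTraversalBound`, stmt-CriticalPhenomena-1878; line `excursion-domination`,
geometric core of the registered stub `stub_shellIterationCore`)

The Kemppainen–Smirnov iteration for the critical self-avoiding walk runs ON THE LATTICE: its
observation times, its index and its collar structures are all read off the sequence of lattice
sites of the walk, while the tightness statement it must prove (`ShellTight`: Aizenman–Burchard's
hypothesis (H1) with a shell-dependent threshold) is about the MESH POLYLINE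
`⟨p.toCurve (meshPoint δ)⟩ : Curve ℂ` of the walk `p` and its separate traversals
`Curve.HasTraversals k x ρ R` of a spherical shell `D(x; ρ, R)`.  This file is the model-independent
dictionary between the two, for a walk `p` of ANY graph whose vertices are embedded with `ε`-short
edges (`emb`, `dist (emb x) (emb y) ≤ ε` along edges) and, specialised, for sub-graphs of `ℤ²` drawn at
mesh `δ` (`meshPoint δ`, edges of length exactly `δ`):

* `exists_tight_indices` — the DISCRETE TIGHT CROSSING of a real sequence: inside every index window
  on which the sequence passes from `≤ r` to `≥ R` (or back), `r < R`, there is a sub-window doing so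
  whose interior values lie STRICTLY inside `(r, R)` (last index at level `≤ r` before the first index
  at level `≥ R`);
* `exists_indexTraversals_of_hasTraversals_toCurve` — `k` separate traversals of `D(x; r, R)` by the
  polyline give `k` index windows `i m ≤ j m ≤ p.length`, weakly increasing (`j m ≤ i m'` for
  `m < m'`), whose end vertices lie on opposite sides of the shrunk shell `D(x; r + ε, R - ε)`;
* `exists_sepIndexTraversals_of_hasTraversals_toCurve` — `2k` separate traversals give `k` STRICTLY
  separated such windows (`j m < i m'`) across any shell nested `ε`-inside;
* `exists_tightIndexTraversals_of_hasTraversals_toCurve` — the same `k` windows made tight: interior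
  vertices strictly inside the open annulus `r + ε < |· - x| < R - ε` (the form the iteration consumes:
  a tight lattice crossing lives in ONE connected component of the lattice annulus);
* `hasTraversals_toCurve_of_indexTraversals` / `hasTraversals_toCurve_of_sepIndexTraversals` — the
  converses: weakly increasing index windows across `D(x; r, R)` give `k` separate traversals of every
  strictly shrunk shell, strictly separated ones give `k` separate traversals of `D(x; r, R)` itself;
* the `ℤ²` forms at mesh `δ` (`G ≤ zdGraph 2`, `emb := meshPoint δ`, `ε := δ`), registered sub-goals
  of the stub: `latticeTightCrossings_of_hasTraversals_toCurve`,
  `latticeSepTightCrossings_of_hasTraversals_toCurve`, `hasTraversals_toCurve_of_latticeCrossings`,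
  `hasTraversals_toCurve_of_latticeSepCrossings`.

The polyline side is the tree's list-level dictionary (`vertexTraversals_of_hasTraversals_polyline`,
`hasTraversals_polyline_of_vertexTraversals`, `hasTraversals_polyline_of_sepVertexTraversals`,
`sepVertexTraversals_of_two_mul`); this file re-indexes it by `SimpleGraph.Walk.getVert` (the indexing
of `Walk.take` / `Walk.drop` used by stopping-time arguments).  The short-distance cutoff is NOT repeated:
it is the tree's `Theorems.not_hasTraversals_domainSAW_of_le_mesh` / `Theorems.hasTraversals_toCurve_le`.

References: M. Aizenman, A. Burchard, Duke Math. J. 99 (1999) §1.b, §3.a; A. Kemppainen, S. Smirnov,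
Ann. Probab. 45 (2017) §2.2–§3 (crossings of annuli read at stopping times).  All statements folklore.
-/

noncomputable section

open Set Metric
open scoped unitInterval
open Literature.Probability.RandomPlanarGeometry Literature.Probability.LatticeModels

namespace Summit.CriticalPhenomena.SAWScalingLimit.Theorems.FKGToTraversalBound.ExcursionDomination.ShellIteration

/-! ### Tight crossings of a real sequence -/

/-- **Discrete tight crossing, upward case.** If `d i ≤ r` and `R ≤ d j` with `i ≤ j` and `r < R`,
then for the first index `j' ∈ [i, j]` at level `≥ R` and the last index `i' ∈ [i, j']` at level `≤ r`
every value strictly between lies strictly inside `(r, R)`. [folklore] -/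
theorem exists_tight_indices_up {d : ℕ → ℝ} {r R : ℝ} (hrR : r < R) {i j : ℕ} (hij : i ≤ j)
    (hi : d i ≤ r) (hj : R ≤ d j) :
    ∃ i' j' : ℕ, i ≤ i' ∧ i' < j' ∧ j' ≤ j ∧ d i' ≤ r ∧ R ≤ d j' ∧
      ∀ n, i' < n → n < j' → r < d n ∧ d n < R := by
  classical
  have hex : ∃ n, i ≤ n ∧ R ≤ d n := ⟨j, hij, hj⟩
  set j' := Nat.find hex with hj'
  have hj'spec : i ≤ j' ∧ R ≤ d j' := Nat.find_spec hex
  have hj'le : j' ≤ j := Nat.find_min' hex ⟨hij, hj⟩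
  have hj'min : ∀ n, n < j' → i ≤ n → d n < R := fun n hn hin => by
    have := Nat.find_min hex hn
    push Not at this
    exact this hin
  set i' := Nat.findGreatest (fun n => d n ≤ r) j' with hi'
  have hii' : i ≤ i' := Nat.le_findGreatest hj'spec.1 hi
  have hi'le : i' ≤ j' := Nat.findGreatest_le j'
  have hi'spec : d i' ≤ r := Nat.findGreatest_spec (P := fun n => d n ≤ r) hj'spec.1 hi
  have hne : i' ≠ j' := fun h => by
    have h1 : R ≤ d i' := h ▸ hj'spec.2
    linarith
  refine ⟨i', j', hii', lt_of_le_of_ne hi'le hne, hj'le, hi'spec, hj'spec.2, fun n hn hnj => ⟨?_, ?_⟩⟩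
  · by_contra hle
    exact Nat.findGreatest_is_greatest hn hnj.le (not_lt.1 hle)
  · exact hj'min n hnj (hii'.trans hn.le)

/-- **Discrete tight crossing** (either direction). Inside every index window `[i, j]` on which a
real sequence passes from the level `≤ r` to the level `≥ R` or back (`r < R`) there is a sub-window
`[i', j']`, `i ≤ i' < j' ≤ j`, doing the same whose interior values lie strictly inside `(r, R)`. On the
lattice: every crossing of a closed annulus by a walk contains a tight crossing, whose interior sites
lie in the open annulus and hence in ONE connected component of its lattice points. [folklore] -/
theorem exists_tight_indices {d : ℕ → ℝ} {r R : ℝ} (hrR : r < R) {i j : ℕ} (hij : i ≤ j)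
    (h : (d i ≤ r ∧ R ≤ d j) ∨ (R ≤ d i ∧ d j ≤ r)) :
    ∃ i' j' : ℕ, i ≤ i' ∧ i' < j' ∧ j' ≤ j ∧
      ((d i' ≤ r ∧ R ≤ d j') ∨ (R ≤ d i' ∧ d j' ≤ r)) ∧
      ∀ n, i' < n → n < j' → r < d n ∧ d n < R := by
  rcases h with ⟨hi, hj⟩ | ⟨hi, hj⟩
  · obtain ⟨i', j', h1, h2, h3, h4, h5, h6⟩ := exists_tight_indices_up hrR hij hi hj
    exact ⟨i', j', h1, h2, h3, Or.inl ⟨h4, h5⟩, h6⟩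
  · obtain ⟨i', j', h1, h2, h3, h4, h5, h6⟩ :=
      exists_tight_indices_up (d := fun n => -d n) (neg_lt_neg hrR) hij (neg_le_neg hi)
        (neg_le_neg hj)
    refine ⟨i', j', h1, h2, h3, Or.inr ⟨by linarith, by linarith⟩, fun n hn hnj => ?_⟩
    obtain ⟨h7, h8⟩ := h6 n hn hnj
    exact ⟨by linarith, by linarith⟩

/-! ### Walks of a graph with short embedded edges -/

section Generic

variable {V E : Type*} {G : SimpleGraph V} {u v : V}

/-- The list of embedded support vertices of a walk has `length + 1` entries. [folklore] -/
theorem length_map_support (emb : V → E) (p : G.Walk u v) :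
    (p.support.map emb).length = p.length + 1 := by
  rw [List.length_map, SimpleGraph.Walk.length_support]

/-- The `n`-th embedded support vertex of a walk is the embedding of its `n`-th vertex `p.getVert n`.
[folklore] -/
theorem get_map_support (emb : V → E) (p : G.Walk u v) (n : Fin (p.support.map emb).length) :
    (p.support.map emb).get n = emb (p.getVert n) := by
  rw [List.get_eq_getElem, List.getElem_map, SimpleGraph.Walk.support_getElem_eq_getVert]

/-- The embedded support list of a walk, in head :: tail form. [folklore] -/
theorem map_support_eq_cons (emb : V → E) (p : G.Walk u v) :
    p.support.map emb = emb u :: p.support.tail.map emb := by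
  conv_lhs => rw [← p.cons_tail_support]
  rfl

/-- Along a walk of a graph whose edges are `ε`-short under `emb`, consecutive embedded support
vertices are `ε`-close. [folklore] -/
theorem isChain_map_support [PseudoMetricSpace E] {ε : ℝ} (emb : V → E)
    (hG : ∀ ⦃x y : V⦄, G.Adj x y → dist (emb x) (emb y) ≤ ε) (p : G.Walk u v) :
    List.IsChain (fun a b : E => dist a b ≤ ε) (p.support.map emb) :=
  List.isChain_map_of_isChain emb (fun _ _ hxy => hG hxy) p.isChain_adj_support

/-- The `n`-th entry of the head :: tail form of the embedded support list is the embedding of the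
`n`-th vertex. [folklore] -/
theorem get_cons_map_support_tail (emb : V → E) (p : G.Walk u v)
    (n : Fin (emb u :: p.support.tail.map emb).length) :
    (emb u :: p.support.tail.map emb).get n = emb (p.getVert n) := by
  rw [List.get_of_eq (map_support_eq_cons emb p).symm, get_map_support]

/-- **Re-indexing.** `Fin`-indexed windows into the head :: tail form of the embedded support list,
with a relation `P` between the two end points and a relation `Q` between consecutive windows, are
`ℕ`-indexed windows `≤ p.length` into the vertex sequence `p.getVert`. [folklore] -/
theorem indexWindows_of_listWindows (emb : V → E) (p : G.Walk u v) {k : ℕ} {P : E → E → Prop}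
    {Q : ℕ → ℕ → Prop}
    (h : ∃ ι κ : Fin k → Fin (emb u :: p.support.tail.map emb).length, (∀ m, ι m ≤ κ m) ∧
      (∀ m, P ((emb u :: p.support.tail.map emb).get (ι m))
        ((emb u :: p.support.tail.map emb).get (κ m))) ∧
      ∀ ⦃m m'⦄, m < m' → Q (κ m) (ι m')) :
    ∃ i j : Fin k → ℕ, (∀ m, i m ≤ j m) ∧ (∀ m, j m ≤ p.length) ∧
      (∀ m, P (emb (p.getVert (i m))) (emb (p.getVert (j m)))) ∧ ∀ ⦃m m'⦄, m < m' → Q (j m) (i m') := by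
  obtain ⟨ι, κ, h1, h2, h3⟩ := h
  have hlen : (emb u :: p.support.tail.map emb).length = p.length + 1 := by
    rw [← map_support_eq_cons, length_map_support]
  have hget := get_cons_map_support_tail emb p
  refine ⟨fun m => (ι m : ℕ), fun m => (κ m : ℕ), fun m => h1 m, fun m => ?_, fun m => ?_,
    fun m m' hmm' => h3 hmm'⟩
  · have := (κ m).isLt
    dsimp only
    omega
  · have := h2 m
    rwa [hget, hget] at this

variable [NormedAddCommGroup E] [NormedSpace ℝ E]

/-- The curve of a walk is the polyline through the head :: tail form of its embedded support list.
[folklore] -/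
theorem toCurve_eq_polyline_cons (emb : V → E) (p : G.Walk u v) :
    (⟨p.toCurve emb⟩ : Curve E) = ⟨polyline (emb u :: p.support.tail.map emb)⟩ := by
  rw [SimpleGraph.Walk.toCurve, map_support_eq_cons]

/-- **Separate traversals of the polyline give weakly increasing index windows across the shrunk
shell.** Let the edges of `G` be `ε`-short under `emb` (`ε ≥ 0`). If the polyline of the walk `p`
traverses `D(x; r, R)` by `k` separate segments, there are index windows `i m ≤ j m ≤ p.length`,
`m < k`, weakly increasing (`j m ≤ i m'` for `m < m'`; consecutive windows may share an end index),
such that the vertices `p.getVert (i m)`, `p.getVert (j m)` lie on opposite sides of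
`D(x; r + ε, R - ε)`: one embedded within `r + ε` of `x`, the other at distance `≥ R - ε`.
(Each traversal time is replaced by the index of the segment carrying it.)
[cite: AizenmanBurchardDuke1999, §3.a (proof of Lemma 3.1)] -/
theorem exists_indexTraversals_of_hasTraversals_toCurve {ε : ℝ} (hε : 0 ≤ ε) (emb : V → E)
    (hG : ∀ ⦃x y : V⦄, G.Adj x y → dist (emb x) (emb y) ≤ ε) (p : G.Walk u v) {k : ℕ} {x : E}
    {r R : ℝ} (h : (⟨p.toCurve emb⟩ : Curve E).HasTraversals k x r R) :
    ∃ i j : Fin k → ℕ, (∀ m, i m ≤ j m) ∧ (∀ m, j m ≤ p.length) ∧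
      (∀ m, (dist (emb (p.getVert (i m))) x ≤ r + ε ∧ R - ε ≤ dist (emb (p.getVert (j m))) x) ∨
        (R - ε ≤ dist (emb (p.getVert (i m))) x ∧ dist (emb (p.getVert (j m))) x ≤ r + ε)) ∧
      ∀ ⦃m m'⦄, m < m' → j m ≤ i m' := by
  have hchain : List.IsChain (fun a b : E => dist a b ≤ ε) (emb u :: p.support.tail.map emb) :=
    map_support_eq_cons emb p ▸ isChain_map_support emb hG p
  rw [toCurve_eq_polyline_cons] at h
  exact indexWindows_of_listWindows emb p (Q := fun a b => a ≤ b)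
    (P := fun a b => (dist a x ≤ r + ε ∧ R - ε ≤ dist b x) ∨ (R - ε ≤ dist a x ∧ dist b x ≤ r + ε))
    (vertexTraversals_of_hasTraversals_polyline hε hchain h)

/-- **`2k` separate traversals give `k` strictly separated index windows across every shell nested
`ε`-inside.** With `ε`-short edges, if the polyline of `p` traverses `D(x; r, R)` by `2k` separate
segments and `r + ε ≤ r' < R' ≤ R - ε`, there are index windows `i m ≤ j m ≤ p.length`, STRICTLY
increasing (`j m < i m'` for `m < m'`), whose end vertices lie on opposite sides of `D(x; r', R')`
(every other one of the `2k` weak windows). [cite: AizenmanBurchardDuke1999, §3.a (proof of Lemma 3.1)] -/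
theorem exists_sepIndexTraversals_of_hasTraversals_toCurve {ε : ℝ} (hε : 0 ≤ ε) (emb : V → E)
    (hG : ∀ ⦃x y : V⦄, G.Adj x y → dist (emb x) (emb y) ≤ ε) (p : G.Walk u v) {k : ℕ} {x : E}
    {r R r' R' : ℝ} (hr : r + ε ≤ r') (hR : R' ≤ R - ε) (hr'R' : r' < R')
    (h : (⟨p.toCurve emb⟩ : Curve E).HasTraversals (2 * k) x r R) :
    ∃ i j : Fin k → ℕ, (∀ m, i m ≤ j m) ∧ (∀ m, j m ≤ p.length) ∧
      (∀ m, (dist (emb (p.getVert (i m))) x ≤ r' ∧ R' ≤ dist (emb (p.getVert (j m))) x) ∨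
        (R' ≤ dist (emb (p.getVert (i m))) x ∧ dist (emb (p.getVert (j m))) x ≤ r')) ∧
      ∀ ⦃m m'⦄, m < m' → j m < i m' := by
  have hchain : List.IsChain (fun a b : E => dist a b ≤ ε) (emb u :: p.support.tail.map emb) :=
    map_support_eq_cons emb p ▸ isChain_map_support emb hG p
  rw [toCurve_eq_polyline_cons] at h
  exact indexWindows_of_listWindows emb p (Q := fun a b => a < b)
    (P := fun a b => (dist a x ≤ r' ∧ R' ≤ dist b x) ∨ (R' ≤ dist a x ∧ dist b x ≤ r'))
    (sepVertexTraversals_of_two_mul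
      (vertexTraversals_mono (vertexTraversals_of_hasTraversals_polyline hε hchain h) hr hR) hr'R')

/-- **Tight index windows.** With `ε`-short edges, if the polyline of `p` traverses `D(x; r, R)` by
`k` separate segments and `r + ε < R - ε`, there are index windows `i m < j m ≤ p.length`, weakly
increasing (`j m ≤ i m'` for `m < m'`), whose end vertices lie on opposite sides of
`D(x; r + ε, R - ε)` and whose INTERIOR vertices `p.getVert n`, `i m < n < j m`, are embedded strictly
inside the open annulus `r + ε < |· - x| < R - ε` (`exists_indexTraversals_of_hasTraversals_toCurve`
tightened window by window by `exists_tight_indices`). [cite: AizenmanBurchardDuke1999, §3.a] -/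
theorem exists_tightIndexTraversals_of_hasTraversals_toCurve {ε : ℝ} (hε : 0 ≤ ε) (emb : V → E)
    (hG : ∀ ⦃x y : V⦄, G.Adj x y → dist (emb x) (emb y) ≤ ε) (p : G.Walk u v) {k : ℕ} {x : E}
    {r R : ℝ} (hrR : r + ε < R - ε) (h : (⟨p.toCurve emb⟩ : Curve E).HasTraversals k x r R) :
    ∃ i j : Fin k → ℕ, (∀ m, i m < j m) ∧ (∀ m, j m ≤ p.length) ∧
      (∀ m, (dist (emb (p.getVert (i m))) x ≤ r + ε ∧ R - ε ≤ dist (emb (p.getVert (j m))) x) ∨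
        (R - ε ≤ dist (emb (p.getVert (i m))) x ∧ dist (emb (p.getVert (j m))) x ≤ r + ε)) ∧
      (∀ m n, i m < n → n < j m →
        r + ε < dist (emb (p.getVert n)) x ∧ dist (emb (p.getVert n)) x < R - ε) ∧
      ∀ ⦃m m'⦄, m < m' → j m ≤ i m' := by
  obtain ⟨i, j, h1, h2, h3, h4⟩ := exists_indexTraversals_of_hasTraversals_toCurve hε emb hG p h
  choose i' j' hi' hi'j' hj' hside hint using
    fun m => exists_tight_indices (d := fun n => dist (emb (p.getVert n)) x) hrR (h1 m) (h3 m)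
  refine ⟨i', j', hi'j', fun m => (hj' m).trans (h2 m), hside, fun m n hn hnj => hint m n hn hnj,
    fun m m' hmm' => ((hj' m).trans (h4 hmm')).trans (hi' m')⟩

/-- **Strictly separated tight index windows from `2k` traversals.** With `ε`-short edges, if the
polyline of `p` traverses `D(x; r, R)` by `2k` separate segments and `r + ε ≤ r' < R' ≤ R - ε`, there
are `k` index windows `i m < j m ≤ p.length`, STRICTLY increasing (`j m < i m'` for `m < m'`), with end
vertices embedded on opposite sides of `D(x; r', R')` and interior vertices embedded strictly inside the
open annulus `r' < |· - x| < R'`. [cite: AizenmanBurchardDuke1999, §3.a] -/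
theorem exists_sepTightIndexTraversals_of_hasTraversals_toCurve {ε : ℝ} (hε : 0 ≤ ε) (emb : V → E)
    (hG : ∀ ⦃x y : V⦄, G.Adj x y → dist (emb x) (emb y) ≤ ε) (p : G.Walk u v) {k : ℕ} {x : E}
    {r R r' R' : ℝ} (hr : r + ε ≤ r') (hR : R' ≤ R - ε) (hr'R' : r' < R')
    (h : (⟨p.toCurve emb⟩ : Curve E).HasTraversals (2 * k) x r R) :
    ∃ i j : Fin k → ℕ, (∀ m, i m < j m) ∧ (∀ m, j m ≤ p.length) ∧
      (∀ m, (dist (emb (p.getVert (i m))) x ≤ r' ∧ R' ≤ dist (emb (p.getVert (j m))) x) ∨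
        (R' ≤ dist (emb (p.getVert (i m))) x ∧ dist (emb (p.getVert (j m))) x ≤ r')) ∧
      (∀ m n, i m < n → n < j m → r' < dist (emb (p.getVert n)) x ∧ dist (emb (p.getVert n)) x < R') ∧
      ∀ ⦃m m'⦄, m < m' → j m < i m' := by
  obtain ⟨i, j, h1, h2, h3, h4⟩ :=
    exists_sepIndexTraversals_of_hasTraversals_toCurve hε emb hG p hr hR hr'R' h
  choose i' j' hi' hi'j' hj' hside hint using
    fun m => exists_tight_indices (d := fun n => dist (emb (p.getVert n)) x) hr'R' (h1 m) (h3 m)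
  refine ⟨i', j', hi'j', fun m => (hj' m).trans (h2 m), hside, fun m n hn hnj => hint m n hn hnj,
    fun m m' hmm' => ((hj' m).trans_lt (h4 hmm')).trans_le (hi' m')⟩

/-- **Converse, weak windows: separate traversals of every strictly shrunk shell.** If a walk `p` has
`k` index windows `i m ≤ j m ≤ p.length`, weakly increasing (`j m ≤ i m'` for `m < m'`), whose end
vertices are embedded on opposite sides of `D(x; r, R)`, then its polyline traverses every strictly
shrunk shell `D(x; r', R')`, `r < r' < R' < R`, by `k` separate segments (the vertices are polyline
points at increasing times; re-time by the intermediate value theorem).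
[cite: AizenmanBurchardDuke1999, §3.a (proof of Lemma 3.1)] -/
theorem hasTraversals_toCurve_of_indexTraversals (emb : V → E) (p : G.Walk u v) {k : ℕ} {x : E}
    {r r' R' R : ℝ} (hrr' : r < r') (hr'R' : r' < R') (hR'R : R' < R) (i j : Fin k → ℕ)
    (hij : ∀ m, i m ≤ j m) (hj : ∀ m, j m ≤ p.length)
    (hside : ∀ m, (dist (emb (p.getVert (i m))) x ≤ r ∧ R ≤ dist (emb (p.getVert (j m))) x) ∨
      (R ≤ dist (emb (p.getVert (i m))) x ∧ dist (emb (p.getVert (j m))) x ≤ r))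
    (hsep : ∀ ⦃m m'⦄, m < m' → j m ≤ i m') :
    (⟨p.toCurve emb⟩ : Curve E).HasTraversals k x r' R' := by
  have hlen := length_map_support emb p
  have hilt : ∀ m, i m < (p.support.map emb).length := fun m => by
    have := hij m; have := hj m; omega
  have hjlt : ∀ m, j m < (p.support.map emb).length := fun m => by have := hj m; omega
  have key := hasTraversals_polyline_of_vertexTraversals (l := p.support.map emb) (k := k) (x := x)
    hrr' hr'R' hR'R ⟨fun m => ⟨i m, hilt m⟩, fun m => ⟨j m, hjlt m⟩, fun m => hij m, fun m => by
      rw [get_map_support, get_map_support]; exact hside m, fun m m' hmm' => hsep hmm'⟩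
  exact key

/-- **Converse, strictly separated windows: separate traversals of the same shell.** If a walk `p`
has `k` index windows `i m ≤ j m ≤ p.length`, strictly increasing (`j m < i m'` for `m < m'`), whose
end vertices are embedded on opposite sides of `D(x; r, R)`, then its polyline traverses `D(x; r, R)`
by `k` separate segments (the vertices are polyline points at strictly increasing times).
[cite: AizenmanBurchardDuke1999, §1.b (1.3)] -/
theorem hasTraversals_toCurve_of_sepIndexTraversals (emb : V → E) (p : G.Walk u v) {k : ℕ} {x : E}
    {r R : ℝ} (i j : Fin k → ℕ) (hij : ∀ m, i m ≤ j m) (hj : ∀ m, j m ≤ p.length)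
    (hside : ∀ m, (dist (emb (p.getVert (i m))) x ≤ r ∧ R ≤ dist (emb (p.getVert (j m))) x) ∨
      (R ≤ dist (emb (p.getVert (i m))) x ∧ dist (emb (p.getVert (j m))) x ≤ r))
    (hsep : ∀ ⦃m m'⦄, m < m' → j m < i m') :
    (⟨p.toCurve emb⟩ : Curve E).HasTraversals k x r R := by
  have hlen := length_map_support emb p
  have hilt : ∀ m, i m < (p.support.map emb).length := fun m => by
    have := hij m; have := hj m; omega
  have hjlt : ∀ m, j m < (p.support.map emb).length := fun m => by have := hj m; omega
  have key := hasTraversals_polyline_of_sepVertexTraversals (l := p.support.map emb) (k := k) (x := x)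
    (r := r) (R := R) ⟨fun m => ⟨i m, hilt m⟩, fun m => ⟨j m, hjlt m⟩, fun m => hij m, fun m => by
      rw [get_map_support, get_map_support]; exact hside m, fun m m' hmm' => hsep hmm'⟩
  exact key

end Generic

/-! ### Sub-graphs of `ℤ²` at mesh `δ` -/

/-- Edges of a sub-graph of `ℤ²` drawn at mesh `δ ≥ 0` have length `≤ δ` (in fact `= δ`,
`Percolation.dist_meshPoint_of_adj`). [folklore] -/
theorem dist_meshPoint_le_of_le_zdGraph {G : SimpleGraph (Site 2)} (hG : G ≤ zdGraph 2) {δ : ℝ}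
    (hδ : 0 ≤ δ) ⦃x y : Site 2⦄ (hxy : G.Adj x y) : dist (meshPoint δ x) (meshPoint δ y) ≤ δ := by
  rw [Literature.Probability.Percolation.dist_meshPoint_of_adj (hG hxy), abs_of_nonneg hδ]

/-! ### The `ℤ²` forms (registered sub-goals H1/H2 of `stub_shellIterationCore`)

The four statements below are the `ℤ²`-at-mesh-`δ` forms, with all binders after the colon, exactly as
registered on stmt-CriticalPhenomena-1878 (`ledger workitem stub-add`); each is a one-line application
of the generic API above with `emb := meshPoint δ`, `ε := δ`. -/

/-- **H1 (registered): separate traversals of the mesh polyline ⇒ tight lattice crossings.** For a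
walk `p` of a sub-graph of `ℤ²` at mesh `δ ≥ 0` whose mesh polyline traverses `D(x; ρ, R)` by `k`
separate segments, `ρ + δ < R - δ`: `k` index windows `i m < j m ≤ p.length`, weakly increasing, end
sites on opposite sides of `D(x; ρ + δ, R - δ)`, interior sites strictly inside the open annulus.
[cite: AizenmanBurchardDuke1999, §3.a] -/
theorem latticeTightCrossings_of_hasTraversals_toCurve :
    ∀ {G : SimpleGraph (Site 2)} {u v : Site 2} (δ : ℝ) (p : G.Walk u v) (k : ℕ) (x : ℂ) (ρ R : ℝ),
      G ≤ zdGraph 2 → 0 ≤ δ → ρ + δ < R - δ →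
      (⟨p.toCurve (meshPoint δ)⟩ : Curve ℂ).HasTraversals k x ρ R →
      ∃ i j : Fin k → ℕ, (∀ m, i m < j m) ∧ (∀ m, j m ≤ p.length) ∧
        (∀ m, (dist (meshPoint δ (p.getVert (i m))) x ≤ ρ + δ ∧
            R - δ ≤ dist (meshPoint δ (p.getVert (j m))) x) ∨
          (R - δ ≤ dist (meshPoint δ (p.getVert (i m))) x ∧
            dist (meshPoint δ (p.getVert (j m))) x ≤ ρ + δ)) ∧
        (∀ m n, i m < n → n < j m →
          ρ + δ < dist (meshPoint δ (p.getVert n)) x ∧ dist (meshPoint δ (p.getVert n)) x < R - δ) ∧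
        ∀ ⦃m m'⦄, m < m' → j m ≤ i m' :=
  fun _ p _ _ _ _ hG hδ hρR h =>
    exists_tightIndexTraversals_of_hasTraversals_toCurve hδ _ (dist_meshPoint_le_of_le_zdGraph hG hδ)
      p hρR h

/-- **H1' (registered): `2k` separate traversals of the mesh polyline ⇒ `k` strictly separated tight
lattice crossings** of every shell nested `δ`-inside (`ρ + δ ≤ ρ' < R' ≤ R - δ`).
[cite: AizenmanBurchardDuke1999, §3.a] -/
theorem latticeSepTightCrossings_of_hasTraversals_toCurve :
    ∀ {G : SimpleGraph (Site 2)} {u v : Site 2} (δ : ℝ) (p : G.Walk u v) (k : ℕ) (x : ℂ)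
      (ρ R ρ' R' : ℝ), G ≤ zdGraph 2 → 0 ≤ δ → ρ + δ ≤ ρ' → R' ≤ R - δ → ρ' < R' →
      (⟨p.toCurve (meshPoint δ)⟩ : Curve ℂ).HasTraversals (2 * k) x ρ R →
      ∃ i j : Fin k → ℕ, (∀ m, i m < j m) ∧ (∀ m, j m ≤ p.length) ∧
        (∀ m, (dist (meshPoint δ (p.getVert (i m))) x ≤ ρ' ∧
            R' ≤ dist (meshPoint δ (p.getVert (j m))) x) ∨
          (R' ≤ dist (meshPoint δ (p.getVert (i m))) x ∧
            dist (meshPoint δ (p.getVert (j m))) x ≤ ρ')) ∧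
        (∀ m n, i m < n → n < j m →
          ρ' < dist (meshPoint δ (p.getVert n)) x ∧ dist (meshPoint δ (p.getVert n)) x < R') ∧
        ∀ ⦃m m'⦄, m < m' → j m < i m' :=
  fun _ p _ _ _ _ _ _ hG hδ hρ hR hρ'R' h =>
    exists_sepTightIndexTraversals_of_hasTraversals_toCurve hδ _ (dist_meshPoint_le_of_le_zdGraph hG hδ)
      p hρ hR hρ'R' h

/-- **H2 (registered): weakly increasing lattice crossings ⇒ separate traversals of every strictly
shrunk shell** by the mesh polyline (any `δ`, any graph on the sites of `ℤ²`).
[cite: AizenmanBurchardDuke1999, §3.a] -/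
theorem hasTraversals_toCurve_of_latticeCrossings :
    ∀ {G : SimpleGraph (Site 2)} {u v : Site 2} (δ : ℝ) (p : G.Walk u v) (k : ℕ) (x : ℂ)
      (r r' R' R : ℝ) (i j : Fin k → ℕ), r < r' → r' < R' → R' < R →
      (∀ m, i m ≤ j m) → (∀ m, j m ≤ p.length) →
      (∀ m, (dist (meshPoint δ (p.getVert (i m))) x ≤ r ∧ R ≤ dist (meshPoint δ (p.getVert (j m))) x) ∨
        (R ≤ dist (meshPoint δ (p.getVert (i m))) x ∧ dist (meshPoint δ (p.getVert (j m))) x ≤ r)) →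
      (∀ ⦃m m'⦄, m < m' → j m ≤ i m') →
      (⟨p.toCurve (meshPoint δ)⟩ : Curve ℂ).HasTraversals k x r' R' :=
  fun _ p _ _ _ _ _ _ i j hrr' hr'R' hR'R hij hj hside hsep =>
    hasTraversals_toCurve_of_indexTraversals _ p hrr' hr'R' hR'R i j hij hj hside hsep

/-- **H2' (registered): strictly increasing lattice crossings ⇒ separate traversals of the same
shell** by the mesh polyline. [cite: AizenmanBurchardDuke1999, §1.b (1.3)] -/
theorem hasTraversals_toCurve_of_latticeSepCrossings :
    ∀ {G : SimpleGraph (Site 2)} {u v : Site 2} (δ : ℝ) (p : G.Walk u v) (k : ℕ) (x : ℂ) (r R : ℝ)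
      (i j : Fin k → ℕ), (∀ m, i m ≤ j m) → (∀ m, j m ≤ p.length) →
      (∀ m, (dist (meshPoint δ (p.getVert (i m))) x ≤ r ∧ R ≤ dist (meshPoint δ (p.getVert (j m))) x) ∨
        (R ≤ dist (meshPoint δ (p.getVert (i m))) x ∧ dist (meshPoint δ (p.getVert (j m))) x ≤ r)) →
      (∀ ⦃m m'⦄, m < m' → j m < i m') →
      (⟨p.toCurve (meshPoint δ)⟩ : Curve ℂ).HasTraversals k x r R :=
  fun _ p _ _ _ _ i j hij hj hside hsep =>
    hasTraversals_toCurve_of_sepIndexTraversals _ p i j hij hj hside hsep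

end Summit.CriticalPhenomena.SAWScalingLimit.Theorems.FKGToTraversalBound.ExcursionDomination.ShellIteration
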